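import Mathlib
import HarnessLib
import Summits.HubbardSuperconductivity.HubbardSuperconductivity.Theorems.KLProgrammeThinLevelSetTripleCount
import Summits.HubbardSuperconductivity.HubbardSuperconductivity.Theorems.KLProgrammeAbsUmklappSectorGrid

/-!
# Route `KLProgramme` — K3 engine (stmt-HubbardSuperconductivity-20437), stub (b) (ℓ)/(I2)–(I3), located item «ABS-UMK-COUNT»:
# the LABEL-TRIPLE COUNT — triples of sector labels in a cone whose chart values satisfy the two windows

Cell gate-hubbard-kl, seat p4 g15 (route HOME/prover-p4/UV-REMEASURE-COUNT.md §5, steps (3)–(4) at the level of sector LABELS).  Combine part 8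
(`ThinLevelSet.card_tripleWindow_le`, triples of an `h`-separated bounded set of reals in the two windows) with the sector grid lemma
(`sectorGrid_chart_*`: the chart values `u(ω) = U(rep(θ_{n,ω} − θ⋆))` of the sector centres within torus distance `Ψ` of `θ⋆` are injective in `ω`,
pairwise `≥ (m)·w_n` apart and bounded by `M·Ψ`):

* **`card_labelTriples_le`** — the number of label triples `(ω_a, ω_b, ω_c)` of scale `n` with all three centres within torus distance `Ψ` of `θ⋆` and
  `|u(ω_a) + u(ω_b) + u(ω_c) − τ| ≤ δ_t`, `|f(u(ω_a)) + f(u(ω_b)) + f(u(ω_c)) − β| ≤ δ_n` is at most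
  `(2δ_t/h + 1)·960A(2(δ_n + Bδ_t) + (4B+1)h)/(c²h²)` with `h = m·w_n`, for any chart coordinate `U` (bi-Lipschitz on `[−Φ, Φ] ⊇ [−Ψ, Ψ]`, `U 0 = 0`)
  and any graph function `f` as in part 8 on `[−Λ, Λ]`, `Λ ≥ 6MΨ + 3δ_t + 2h`.

Everything is PROVED; no definitions, no named facts. [folklore]
-/

noncomputable section

open Real Set
open Literature.MathematicalPhysics.QuantumLattice Literature.MathematicalPhysics.QuantumLattice.FermiRG
open Summit.HubbardSuperconductivity.HubbardSuperconductivity.Theorems.ThinLevelSet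

namespace Summit.HubbardSuperconductivity.HubbardSuperconductivity.Theorems.AbsUmklappCount

set_option linter.dupNamespace false -- summit = problem name (single-conjunct summit), D-0017

open Classical in
/-- **The label-triple count.**  See the module docstring; `u ω := U(θ_{n,ω} − θ⋆ − round((θ_{n,ω} − θ⋆)/2π)·2π)`. [folklore] -/
theorem card_labelTriples_le {U f f' f'' : ℝ → ℝ} (hfm : Measurable f) {Φ Ψ m M Λ c A B δt δn : ℝ}
    (hm : 0 < m) (hM : 0 ≤ M) (hΦ : 0 ≤ Φ) (hΨ : 0 ≤ Ψ) (hΨΦ : Ψ ≤ Φ)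
    (hlow : ∀ φ ∈ Icc (-Φ) Φ, ∀ φ' ∈ Icc (-Φ) Φ, m * |φ - φ'| ≤ |U φ - U φ'|)
    (hup : ∀ φ ∈ Icc (-Φ) Φ, ∀ φ' ∈ Icc (-Φ) Φ, |U φ - U φ'| ≤ M * |φ - φ'|) (hU0 : U 0 = 0)
    (hc : 0 < c) (hcA : c ≤ A) (hB : 0 ≤ B) (hδt : 0 ≤ δt) (hδn : 0 ≤ δn) (n : ℕ)
    (hΛ : 6 * (M * Ψ) + 3 * δt + 2 * (m * sectorWidth n) ≤ Λ)
    (hf : ∀ x ∈ Icc (-Λ) Λ, HasDerivAt f (f' x) x) (hf' : ∀ x ∈ Icc (-Λ) Λ, HasDerivAt f' (f'' x) x)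
    (hfloor : ∀ x ∈ Icc (-Λ) Λ, c ≤ f'' x) (hceil : ∀ x ∈ Icc (-Λ) Λ, f'' x ≤ A) (hder : ∀ x ∈ Icc (-Λ) Λ, |f' x| ≤ B)
    (θs τ β : ℝ) :
    (((Finset.univ : Finset ((Fin (sectorCount n) × Fin (sectorCount n)) × Fin (sectorCount n))).filter
        fun t => torusDist (sectorCenter n t.1.1 - θs) ≤ Ψ ∧ torusDist (sectorCenter n t.1.2 - θs) ≤ Ψ ∧
          torusDist (sectorCenter n t.2 - θs) ≤ Ψ ∧
          |U (sectorCenter n t.1.1 - θs - round ((2 * π)⁻¹ * (sectorCenter n t.1.1 - θs)) * (2 * π)) +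
              U (sectorCenter n t.1.2 - θs - round ((2 * π)⁻¹ * (sectorCenter n t.1.2 - θs)) * (2 * π)) +
              U (sectorCenter n t.2 - θs - round ((2 * π)⁻¹ * (sectorCenter n t.2 - θs)) * (2 * π)) - τ| ≤ δt ∧
          |f (U (sectorCenter n t.1.1 - θs - round ((2 * π)⁻¹ * (sectorCenter n t.1.1 - θs)) * (2 * π))) +
              f (U (sectorCenter n t.1.2 - θs - round ((2 * π)⁻¹ * (sectorCenter n t.1.2 - θs)) * (2 * π))) +
              f (U (sectorCenter n t.2 - θs - round ((2 * π)⁻¹ * (sectorCenter n t.2 - θs)) * (2 * π))) - β| ≤ δn).card : ℝ) ≤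
      (2 * δt / (m * sectorWidth n) + 1) *
        (960 * A * (2 * (δn + B * δt) + (4 * B + 1) * (m * sectorWidth n)) / c ^ 2 / (m * sectorWidth n) ^ 2) := by
  set N := sectorCount n with hN
  set w := sectorWidth n with hw
  have hwpos : 0 < w := sectorWidth_pos n
  set h := m * w with hh
  have hhpos : 0 < h := mul_pos hm hwpos
  -- the chart value of a label
  set uo : Fin N → ℝ := fun ω => U (sectorCenter n ω - θs - round ((2 * π)⁻¹ * (sectorCenter n ω - θs)) * (2 * π)) with huo
  -- the grid of chart values of the cone
  set S : Finset (Fin N) := Finset.univ.filter fun ω => torusDist (sectorCenter n ω - θs) ≤ Ψ with hS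
  set G : Finset ℝ := S.image uo with hG
  have hmemS : ∀ ω, ω ∈ S ↔ torusDist (sectorCenter n ω - θs) ≤ Ψ := fun ω => by rw [hS]; simp
  have hGb : ∀ g ∈ G, |g| ≤ M * Ψ := by
    intro g hg
    rw [hG, Finset.mem_image] at hg
    obtain ⟨ω, hω, rfl⟩ := hg
    exact sectorGrid_chart_bounded hM hΦ hΨΦ hup hU0 (abs_rep_le_of_torusDist_le ((hmemS ω).1 hω))
  have hrepI : ∀ ω ∈ S, sectorCenter n ω - θs - round ((2 * π)⁻¹ * (sectorCenter n ω - θs)) * (2 * π) ∈ Icc (-Φ) Φ := by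
    intro ω hω
    have := abs_le.1 ((abs_rep_le_of_torusDist_le ((hmemS ω).1 hω)).trans hΨΦ)
    exact ⟨this.1, this.2⟩
  have hGsep : ∀ g ∈ G, ∀ g' ∈ G, g ≠ g' → h ≤ |g - g'| := by
    intro g hg g' hg' hne
    rw [hG, Finset.mem_image] at hg hg'
    obtain ⟨ω, hω, rfl⟩ := hg
    obtain ⟨ω', hω', rfl⟩ := hg'
    have hne' : (ω : ℕ) ≠ (ω' : ℕ) := by
      intro heq; exact hne (by rw [Fin.ext heq])
    exact sectorGrid_chart_separated hm.le hlow n θs ω.isLt ω'.isLt hne' (hrepI ω hω) (hrepI ω' hω')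
  -- the injection into the triples of part 8
  set T := ((Finset.univ : Finset ((Fin N × Fin N) × Fin N)).filter
        fun t => torusDist (sectorCenter n t.1.1 - θs) ≤ Ψ ∧ torusDist (sectorCenter n t.1.2 - θs) ≤ Ψ ∧
          torusDist (sectorCenter n t.2 - θs) ≤ Ψ ∧
          |uo t.1.1 + uo t.1.2 + uo t.2 - τ| ≤ δt ∧ |f (uo t.1.1) + f (uo t.1.2) + f (uo t.2) - β| ≤ δn) with hT
  set T' := ((G ×ˢ G) ×ˢ G).filter fun t : (ℝ × ℝ) × ℝ =>
      |t.1.1 + t.1.2 + t.2 - τ| ≤ δt ∧ |f t.1.1 + f t.1.2 + f t.2 - β| ≤ δn with hT'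
  set e : (Fin N × Fin N) × Fin N → (ℝ × ℝ) × ℝ := fun t => ((uo t.1.1, uo t.1.2), uo t.2) with he
  have hinjS : Set.InjOn uo {ω : Fin N | torusDist (sectorCenter n ω - θs) ≤ Ψ} :=
    sectorGrid_chart_injOn hm hΨΦ hlow n θs
  have hmaps : Set.MapsTo e T T' := by
    intro t ht
    have ht' : t ∈ T := by simpa using ht
    rw [hT, Finset.mem_filter] at ht'
    obtain ⟨-, h1, h2, h3, h4, h5⟩ := ht'
    have hm1 : uo t.1.1 ∈ G := by rw [hG]; exact Finset.mem_image_of_mem _ ((hmemS _).2 h1)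
    have hm2 : uo t.1.2 ∈ G := by rw [hG]; exact Finset.mem_image_of_mem _ ((hmemS _).2 h2)
    have hm3 : uo t.2 ∈ G := by rw [hG]; exact Finset.mem_image_of_mem _ ((hmemS _).2 h3)
    show e t ∈ (T' : Set ((ℝ × ℝ) × ℝ))
    rw [Finset.mem_coe, hT', Finset.mem_filter, Finset.mem_product, Finset.mem_product]
    exact ⟨⟨⟨hm1, hm2⟩, hm3⟩, h4, h5⟩
  have hinj : Set.InjOn e T := by
    intro t ht t' ht' hee
    have ht1 : t ∈ T := by simpa using ht
    have ht2 : t' ∈ T := by simpa using ht'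
    rw [hT, Finset.mem_filter] at ht1 ht2
    obtain ⟨-, h1, h2, h3, -, -⟩ := ht1
    obtain ⟨-, h1', h2', h3', -, -⟩ := ht2
    rw [he] at hee
    simp only [Prod.mk.injEq] at hee
    obtain ⟨⟨e1, e2⟩, e3⟩ := hee
    have q1 := hinjS h1 h1' e1
    have q2 := hinjS h2 h2' e2
    have q3 := hinjS h3 h3' e3
    exact Prod.ext (Prod.ext q1 q2) q3
  have hcard : T.card ≤ T'.card := Finset.card_le_card_of_injOn e hmaps hinj
  have hT'card := card_tripleWindow_le hfm (ρ₀ := M * Ψ) (by positivity) hhpos hc hcA hB hδt hδn (by rw [hh]; exact hΛ)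
    hf hf' hfloor hceil hder G hGb hGsep τ β
  have h1 : (T.card : ℝ) ≤ (T'.card : ℝ) := by exact_mod_cast hcard
  exact h1.trans hT'card

end Summit.HubbardSuperconductivity.HubbardSuperconductivity.Theorems.AbsUmklappCount

end
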